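import Summits.ABC.IUTFork.LDHGenuinePerImageShellRat
import HarnessLib

/-!
# The fork at [IUTchIII] Corollary 3.12, L-DH level, READING (P): the rational-point test with the wild log-shell term, UNIFORM IN `l`
# (abc-iut cell, crux ThetaPartII = stmt-ABC-19678; row «C:PERIMAGE-SHELL», part 4)

Record-only PROOF file (D-0012) of the abc-iut cell (WAVE-3 discharge seat abc-iut-c312-d1, gen 9). TAKES NO SIDE on [IUTchIII]
Cor. 3.12. Part 3 (`LDHGenuinePerImageShellRat.cor312PerImageOf_ratPoint_shell`) is a test at ONE prime `l`; its right-hand side is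
MONOTONE in the non-pole prime `l`: the weights `1 − 1/(l·k_p)`, the `l`-adic term `(1 − 1/(l−1))·log l` and the shell
weights `a_p − p^{a_p}/(l·k_p)` all increase with `l`, `log q^{∤2l}(q) = Σ_{p∈I, p≠2} e_p·log p` does not depend on the non-pole `l`, every pole
`2 ≠ p ≤ L₀` is admissible (`l ∤ p − 1` because `0 < p − 1 < l`), and `κ_l = (l+1)/24 − 1/(2l) ≤ (l+1)/24`. Hence ONE inequality at `l = L₀`
settles EVERY prime `l ≥ L₀` (the slope argument of abc-iut-s2-p4's `cor312PerImageOf_ratPoint_uniform`, p471799, now with the sharp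
different weights and the shell term):

* **`Cor22.cor312PerImageOf_ratPoint_shell_uniform`** — `q ∈ ℚ ∖ {0,1}`, `j(q) = N/∏_{p∈I} p^{e_p}`, `L₀ ≥ 7`, a set
  `Psh ⊆ I ∖ {2}` of poles `p ≤ L₀` with exponents `a_p` such that `p^{a_p} ≤ a_p·L₀·k_p` (`k_p = lcm(30/gcd(30,e_p), c_p)`): if
  `(1/6)·Σ_{p∈I, p≠2} e_p·log p ≤ Σ_{p∈I, p≠2} (1 − 1/(L₀·k_p))·log p + ½·log 2 + [3∉I]·½·log 3 + [5∉I]·¾·log 5 + (1 − 1/(L₀−1))·log L₀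
     + Σ_{p∈Psh} (a_p − p^{a_p}/(L₀·k_p))·log p + log π`,
  then for EVERY prime `l ≥ L₀` that is not a pole and EVERY genuine Θ-volume datum `T` of `(q, l)`: `T.Cor312PerImageOf`.

Nothing here asserts the existence of Θ-data, Cor. 3.12 in general or in print's reading, or abc; (Ind2)/the hull are the tree's typings
(reading (P), FULL lattice-automorphism (Ind2)); proved-as-typed ≠ in print. [cite: Mochizuki2012, IUTchI Def. 3.1 (a)(b)(c) p. 61–62;
IUTchIII Cor. 3.12 p. 173–174, proof Step (x) p. 181; IUTchIV Prop. 1.2 (i)(ii) p. 10, Thm. 1.10 Step (ii) p. 24, Step (v) p. 27–29]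
[cite: DupuyHilado2025, §4.9, §4.12] [claim: Mochizuki2012, status: disputed] for every IUT quotation. PROOF-ONLY: no definitions, no new `Prop`.
-/

noncomputable section

open NumberField IsDedekindDomain Ideal Module

namespace Literature.IUT.LogVolume.Cor22

open Literature.NumberTheory.DiophantineGeometry.GenEll Summit.ABC.IUTFork Literature.IUT.HodgeTheaters
open Literature.NumberTheory.NumberFields Literature.NumberTheory.GaloisRepresentations.Ultrametric
open Literature.NumberTheory.DiophantineGeometry.UniformABCConjecture Rat.HeightOneSpectrum

variable {q : ℚ} {N D : ℕ} {I : Finset ℕ} {e : ℕ → ℕ}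

/-- `(1 − 1/(x−1))·log x` is monotone on `7 ≤ x` (both factors are nonnegative and increase). [folklore] -/
private theorem lterm_mono {L l : ℕ} (hL : 7 ≤ L) (hLl : L ≤ l) :
    (1 - ((L - 1 : ℕ) : ℝ)⁻¹) * Real.log L ≤ (1 - ((l - 1 : ℕ) : ℝ)⁻¹) * Real.log l := by
  have hL1 : (6 : ℝ) ≤ ((L - 1 : ℕ) : ℝ) := by
    have : 6 ≤ L - 1 := by omega
    exact_mod_cast this
  have hl1 : ((L - 1 : ℕ) : ℝ) ≤ ((l - 1 : ℕ) : ℝ) := by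
    have : L - 1 ≤ l - 1 := by omega
    exact_mod_cast this
  have hLR : (7 : ℝ) ≤ L := by exact_mod_cast hL
  have hlR : (L : ℝ) ≤ l := by exact_mod_cast hLl
  have hinv : ((l - 1 : ℕ) : ℝ)⁻¹ ≤ ((L - 1 : ℕ) : ℝ)⁻¹ := inv_anti₀ (by linarith) hl1
  have hinvL : ((L - 1 : ℕ) : ℝ)⁻¹ ≤ 6⁻¹ := inv_anti₀ (by norm_num) hL1
  have hlogL : 0 ≤ Real.log L := Real.log_nonneg (by linarith)
  have hlog : Real.log L ≤ Real.log l := Real.log_le_log (by linarith) hlR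
  have h1 : 0 ≤ 1 - ((l - 1 : ℕ) : ℝ)⁻¹ := by linarith
  calc (1 - ((L - 1 : ℕ) : ℝ)⁻¹) * Real.log L ≤ (1 - ((l - 1 : ℕ) : ℝ)⁻¹) * Real.log L :=
        mul_le_mul_of_nonneg_right (by linarith) hlogL
    _ ≤ (1 - ((l - 1 : ℕ) : ℝ)⁻¹) * Real.log l := mul_le_mul_of_nonneg_left hlog h1

/-- **RATIONAL POINTS, THE SHELL TEST UNIFORMLY IN THE PRIME `l ≥ L₀`** (see the module docstring for the statement in words): one
inequality at `l = L₀ ≥ 7` gives [IUTchIII] Cor. 3.12 in the cell's READING (P), AS TYPED, at every genuine Θ-volume datum of `(q, l)`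
for EVERY non-pole prime `l ≥ L₀` (the finitely many pole primes `l ∈ I` are single-`l` rows). [cite: Mochizuki2012, IUTchIII Cor. 3.12 p. 173–174, proof Step (x) p. 181]
[cite: Mochizuki2012, IUTchIV Prop. 1.2 (i)(ii) p. 10, Thm. 1.10 Step (ii) p. 24, Step (v) p. 27–29] [claim: Mochizuki2012, status: disputed] -/
theorem cor312PerImageOf_ratPoint_shell_uniform (hq0 : q ≠ 0) (hq1 : q ≠ 1)
    (hI : ∀ p ∈ I, p.Prime) (he : ∀ p ∈ I, e p ≠ 0) (hD : D = ∏ p ∈ I, p ^ e p)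
    (hj : jInv q = (N : ℚ) / (D : ℚ)) (hN : N ≠ 0) (hcop : ∀ p ∈ I, ¬ p ∣ N)
    (L₀ : ℕ) (hL7 : 7 ≤ L₀)
    (Psh : Finset ℕ) (a : ℕ → ℕ) (hPshI : Psh ⊆ I) (hPsh2 : ∀ p ∈ Psh, p ≠ 2) (hPshL : ∀ p ∈ Psh, p ≤ L₀)
    (hapos : ∀ p ∈ Psh, (p : ℝ) ^ (a p) ≤
      (a p : ℝ) * ((L₀ * Nat.lcm (30 / Nat.gcd 30 (e p)) (if p = 3 then 2 else if p = 5 then 4 else 1) : ℕ) : ℝ))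
    (h : (1 / 6 : ℝ) * (∑ p ∈ I.filter (fun p => p ≠ 2), (e p : ℝ) * Real.log p) ≤
      (∑ p ∈ I.filter (fun p => p ≠ 2),
          (1 - ((L₀ * Nat.lcm (30 / Nat.gcd 30 (e p)) (if p = 3 then 2 else if p = 5 then 4 else 1) : ℕ) : ℝ)⁻¹) * Real.log p)
        + 2⁻¹ * Real.log 2
        + (if 3 ∈ I then 0 else 2⁻¹ * Real.log 3)
        + (if 5 ∈ I then 0 else (3 / 4 : ℝ) * Real.log 5)
        + (1 - ((L₀ - 1 : ℕ) : ℝ)⁻¹) * Real.log L₀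
        + (∑ p ∈ Psh, (((a p : ℕ) : ℝ) - (p : ℝ) ^ (a p) /
            ((L₀ * Nat.lcm (30 / Nat.gcd 30 (e p)) (if p = 3 then 2 else if p = 5 then 4 else 1) : ℕ) : ℝ)) * Real.log p)
        + Real.log Real.pi)
    {l : ℕ} (hl : l.Prime) (hLl : L₀ ≤ l) (hlI : l ∉ I) (T : ThetaVolumeDatumAt (ratPoint q) l) : T.Cor312PerImageOf := by
  classical
  have h7 : 7 ≤ l := le_trans hL7 hLl
  have hl2 : l ≠ 2 := by omega
  -- abbreviations for the weights at `l` and at `L₀`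
  set k : ℕ → ℕ := fun p => Nat.lcm (30 / Nat.gcd 30 (e p)) (if p = 3 then 2 else if p = 5 then 4 else 1) with hk
  have hkpos : ∀ p, 0 < k p := by
    intro p
    refine Nat.pos_of_ne_zero (Nat.lcm_ne_zero ?_ (by split_ifs <;> norm_num))
    exact (Nat.div_pos (Nat.le_of_dvd (by norm_num) (Nat.gcd_dvd_left 30 (e p))) (Nat.gcd_pos_of_pos_left _ (by norm_num))).ne'
  -- the two filters agree: no pole equals `l`
  have hfilter : I.filter (fun p => p ≠ 2 ∧ p ≠ l) = I.filter (fun p => p ≠ 2) := by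
    refine Finset.filter_congr fun p hp => ?_
    exact ⟨fun h => h.1, fun h => ⟨h, fun hpl => hlI (hpl ▸ hp)⟩⟩
  -- `log q^{∤2l}(q) = Σ_{p∈I, p≠2} e_p·log p`
  have hQ : logQAvoid (ratPoint q) {2, l} = ∑ p ∈ I.filter (fun p => p ≠ 2), (e p : ℝ) * Real.log p := by
    rw [logQAvoid_ratPoint_eq_sum hI he hD hj hN {2, l} (fun p hp _ => hcop p hp)]
    refine Finset.sum_congr (Finset.filter_congr fun p hp => ?_) fun _ _ => rfl
    have hpp := hI p hp
    constructor
    · intro hs h2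
      exact hs 2 (by simp) (by rw [h2])
    · intro h2 s hs hps
      simp only [Finset.mem_insert, Finset.mem_singleton] at hs
      rcases hs with rfl | rfl
      · exact h2 ((Nat.prime_dvd_prime_iff_eq hpp Nat.prime_two).mp hps)
      · exact hlI (((Nat.prime_dvd_prime_iff_eq hpp hl).mp hps) ▸ hp)
  -- the admissibility of `Psh` at `l`
  have hPsh : ∀ p ∈ Psh, p ≠ 2 ∧ p ≠ l ∧ ¬ l ∣ p - 1 := by
    intro p hpP
    have hpI := hPshI hpP
    have hpp := hI p hpI
    have hpL := hPshL p hpP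
    refine ⟨hPsh2 p hpP, fun hpl => hlI (hpl ▸ hpI), fun hdvd => ?_⟩
    have hp3 : 3 ≤ p := by
      rcases hpp.eq_two_or_odd with h2 | hodd
      · exact absurd h2 (hPsh2 p hpP)
      · have := hpp.two_le; omega
    have := Nat.le_of_dvd (by omega) hdvd
    omega
  refine cor312PerImageOf_ratPoint_shell hq0 hq1 hl h7 hI he hD hj hN hcop Psh a hPshI hPsh ?_ T
  rw [hQ, hfilter]
  -- monotonicity in `l`
  have hlR : (L₀ : ℝ) ≤ l := by exact_mod_cast hLl
  have hL7R : (7 : ℝ) ≤ L₀ := by exact_mod_cast hL7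
  have hlpos : (0 : ℝ) < l := by linarith
  have hW : ∀ p ∈ I.filter (fun p => p ≠ 2),
      (1 - ((L₀ * k p : ℕ) : ℝ)⁻¹) * Real.log p ≤ (1 - ((l * k p : ℕ) : ℝ)⁻¹) * Real.log p := by
    intro p hp
    have hpp := hI p (Finset.mem_filter.mp hp).1
    have hkp : (0 : ℝ) < k p := by exact_mod_cast hkpos p
    have h1 : ((L₀ * k p : ℕ) : ℝ) ≤ ((l * k p : ℕ) : ℝ) := by exact_mod_cast Nat.mul_le_mul_right _ hLl
    have h0 : (0 : ℝ) < ((L₀ * k p : ℕ) : ℝ) := by push_cast; positivity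
    have hinv := inv_anti₀ h0 h1
    exact mul_le_mul_of_nonneg_right (by linarith) (Real.log_nonneg (by exact_mod_cast hpp.one_lt.le))
  have hWsum := Finset.sum_le_sum hW
  have hS : ∀ p ∈ Psh,
      (((a p : ℕ) : ℝ) - (p : ℝ) ^ (a p) / ((L₀ * k p : ℕ) : ℝ)) * Real.log p ≤
        (((a p : ℕ) : ℝ) - (p : ℝ) ^ (a p) / ((l * k p : ℕ) : ℝ)) * Real.log p := by
    intro p hp
    have hpp := hI p (hPshI hp)
    have hkp : (0 : ℝ) < k p := by exact_mod_cast hkpos p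
    have h1 : ((L₀ * k p : ℕ) : ℝ) ≤ ((l * k p : ℕ) : ℝ) := by exact_mod_cast Nat.mul_le_mul_right _ hLl
    have h0 : (0 : ℝ) < ((L₀ * k p : ℕ) : ℝ) := by push_cast; positivity
    have hdiv := div_le_div_of_nonneg_left (by positivity : (0 : ℝ) ≤ (p : ℝ) ^ (a p)) h0 h1
    exact mul_le_mul_of_nonneg_right (by linarith) (Real.log_nonneg (by exact_mod_cast hpp.one_lt.le))
  have hSsum := Finset.sum_le_sum hS
  have hS0 : 0 ≤ ∑ p ∈ Psh, (((a p : ℕ) : ℝ) - (p : ℝ) ^ (a p) / ((L₀ * k p : ℕ) : ℝ)) * Real.log p := by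
    refine Finset.sum_nonneg fun p hp => ?_
    have hpp := hI p (hPshI hp)
    have hkp : (0 : ℝ) < k p := by exact_mod_cast hkpos p
    have h0 : (0 : ℝ) < ((L₀ * k p : ℕ) : ℝ) := by push_cast; positivity
    have hle : (p : ℝ) ^ (a p) / ((L₀ * k p : ℕ) : ℝ) ≤ (a p : ℝ) := by
      rw [div_le_iff₀ h0]
      exact hapos p hp
    exact mul_nonneg (by push_cast at hle ⊢; linarith) (Real.log_nonneg (by exact_mod_cast hpp.one_lt.le))
  have hLt := lterm_mono hL7 hLl
  have hQ0 : 0 ≤ ∑ p ∈ I.filter (fun p => p ≠ 2), (e p : ℝ) * Real.log p :=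
    Finset.sum_nonneg fun p hp => mul_nonneg (Nat.cast_nonneg _)
      (Real.log_nonneg (by exact_mod_cast (hI p (Finset.mem_filter.mp hp).1).one_lt.le))
  have hpi : 0 < Real.log Real.pi := Real.log_pos (by linarith [Real.pi_gt_three])
  have hlog2 : 0 < Real.log 2 := Real.log_pos (by norm_num)
  have hc3 : 0 ≤ (if 3 ∈ I then 0 else 2⁻¹ * Real.log 3 : ℝ) := by
    split_ifs
    · exact le_rfl
    · exact mul_nonneg (by norm_num) (Real.log_nonneg (by norm_num))
  have hc5 : 0 ≤ (if 5 ∈ I then 0 else (3 / 4 : ℝ) * Real.log 5 : ℝ) := by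
    split_ifs
    · exact le_rfl
    · exact mul_nonneg (by norm_num) (Real.log_nonneg (by norm_num))
  have hW0 : 0 ≤ ∑ p ∈ I.filter (fun p => p ≠ 2), (1 - ((L₀ * k p : ℕ) : ℝ)⁻¹) * Real.log p := by
    refine Finset.sum_nonneg fun p hp => ?_
    have hpp := hI p (Finset.mem_filter.mp hp).1
    have hkp : (0 : ℝ) < k p := by exact_mod_cast hkpos p
    have h1 : (1 : ℝ) ≤ ((L₀ * k p : ℕ) : ℝ) := by exact_mod_cast Nat.mul_pos (by omega) (hkpos p)
    have hinv : ((L₀ * k p : ℕ) : ℝ)⁻¹ ≤ 1 := inv_le_one_of_one_le₀ h1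
    exact mul_nonneg (by linarith) (Real.log_nonneg (by exact_mod_cast hpp.one_lt.le))
  have hLt0 : 0 ≤ (1 - ((L₀ - 1 : ℕ) : ℝ)⁻¹) * Real.log L₀ := by
    have h6 : (6 : ℝ) ≤ ((L₀ - 1 : ℕ) : ℝ) := by
      have : 6 ≤ L₀ - 1 := by omega
      exact_mod_cast this
    have hinv : ((L₀ - 1 : ℕ) : ℝ)⁻¹ ≤ 6⁻¹ := inv_anti₀ (by norm_num) h6
    exact mul_nonneg (by linarith) (Real.log_nonneg (by linarith))
  -- `κ_l ≤ (l+1)/24`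
  have hkap : (((l : ℝ) + 1) / 24 - 1 / (2 * l)) * (∑ p ∈ I.filter (fun p => p ≠ 2), (e p : ℝ) * Real.log p) ≤
      ((l : ℝ) + 1) / 24 * (∑ p ∈ I.filter (fun p => p ≠ 2), (e p : ℝ) * Real.log p) := by
    have : 0 ≤ 1 / (2 * (l : ℝ)) := by positivity
    nlinarith
  -- assemble: `(l+1)/24·Q ≤ (l+1)/4·(Q/6) ≤ (l+1)/4·(W₀ + C₀ + S₀ + log π) ≤ RHS(l)`
  have hmain : ((l : ℝ) + 1) / 24 * (∑ p ∈ I.filter (fun p => p ≠ 2), (e p : ℝ) * Real.log p) ≤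
      (((l : ℝ) + 5) / 4 - 1) *
          ((∑ p ∈ I.filter (fun p => p ≠ 2), (1 - ((l * k p : ℕ) : ℝ)⁻¹) * Real.log p)
            + 2⁻¹ * Real.log 2
            + (if 3 ∈ I then 0 else 2⁻¹ * Real.log 3)
            + (if 5 ∈ I then 0 else (3 / 4 : ℝ) * Real.log 5)
            + (1 - ((l - 1 : ℕ) : ℝ)⁻¹) * Real.log l)
        + ((l : ℝ) + 5) / 4 * (∑ p ∈ Psh, (((a p : ℕ) : ℝ) - (p : ℝ) ^ (a p) / ((l * k p : ℕ) : ℝ)) * Real.log p)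
        + ((l : ℝ) + 5) / 4 * Real.log Real.pi := by
    have hl1 : (0 : ℝ) ≤ ((l : ℝ) + 1) / 4 := by positivity
    have hstep1 : ((l : ℝ) + 1) / 24 * (∑ p ∈ I.filter (fun p => p ≠ 2), (e p : ℝ) * Real.log p) ≤
        ((l : ℝ) + 1) / 4 *
          ((∑ p ∈ I.filter (fun p => p ≠ 2), (1 - ((L₀ * k p : ℕ) : ℝ)⁻¹) * Real.log p)
            + 2⁻¹ * Real.log 2
            + (if 3 ∈ I then 0 else 2⁻¹ * Real.log 3)
            + (if 5 ∈ I then 0 else (3 / 4 : ℝ) * Real.log 5)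
            + (1 - ((L₀ - 1 : ℕ) : ℝ)⁻¹) * Real.log L₀
            + (∑ p ∈ Psh, (((a p : ℕ) : ℝ) - (p : ℝ) ^ (a p) / ((L₀ * k p : ℕ) : ℝ)) * Real.log p)
            + Real.log Real.pi) := by
      have := mul_le_mul_of_nonneg_left h hl1
      linarith
    nlinarith [hstep1, hWsum, hSsum, hS0, hLt, hpi, hl1, hlR, hW0, hLt0, hc3, hc5, hlog2]
  exact le_trans hkap hmain

end Literature.IUT.LogVolume.Cor22

end
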